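import Summits.CriticalPhenomena.PercolationContinuityZ3.Theorems.PercNearOneGluingAdditiveGluingPocketReduction
import HarnessLib

/-!
# `NoHeavyLowerTail` (stmt-CriticalPhenomena-4575) — lossy pocket cover, part 1: combinatorics of the pocket event

Support file (engine seat `prim-cplus-engine` g2; `--supports stmt-CriticalPhenomena-4575`).  No definitions, no
named facts, no sorries.  Vocabulary of the tree's pocket Markov property (`Theorems.stub_pocketMarkov`, crux 4576):
the `A`-avoiding pocket `W(ω) = {v : o ↔ v inside Aᶜ}` of the observer `o` and its first contacts (ports)
`N(ω) = {a ∈ A : o ↔ a inside Aᶜ ∪ {a}}`; `P_{W,N} = {W(ω) = W, N(ω) = N}`.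

On `P_{W,N}` (`o ∉ A`):
* `openConn_observer_iff` — the cluster of `o` is `W ∪ ⋃_{a ∈ N} C_{Wᶜ}(a)`: for `y ∉ W`, `o ↔ y` iff some port is
  joined to `y` INSIDE `Wᶜ` (last exit from `W` of an open walk is an open pair `W–a` with `a` a relay, hence a port);
* `openConn_relay_iff` — the cluster of a vertex `c ∉ W`: `c ↔ y` iff `c ↔ y` inside `Wᶜ`, or `c` meets a port inside
  `Wᶜ` and `y` lies in the cluster of `o` (first entry into `W`);
* `lowerTail_inter_pocket` — `{1 ≤ N_o ≤ j} ∩ P = P ∩ {the glued port block is j-small inside Wᶜ}` (`N ≠ ∅`);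
* `relaySmall_inter_pocket` — `{|π(c)| ≤ j} ∩ P = P ∩ {c is j-small in G[Wᶜ] + K_N}` (`c ∈ A`);
* `lowerTail_inter_pocket_subset_of_mem` (`c ∈ N`), `lowerTail_inter_pocket_empty` (`N = ∅`).
Used by `…LossyPocketCover.lean` (the theorem `bad ≤ Φ_G(c) + GAP(c)`, ENGINE-g2.md §5).
-/

noncomputable section

namespace Summit.CriticalPhenomena.PercolationContinuityZ3.Theorems

open MeasureTheory Set Literature.Probability.LatticeModels Literature.Probability.Percolation
open Literature.Probability.Percolation.DCT16 (pathIn_of_mem_openConnIn mem_openConnIn_of_pathIn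
  reachable_of_pathIn pathIn_induction determinedBy_openConnIn)
open scoped Classical BigOperators

namespace LossyPocket

variable {n : ℕ}

/-! ### Paths: `openConn` versus `PathIn univ`, and transitivity of `openConnIn` -/

/-- Reachability is a path inside `univ`. [folklore] -/
theorem pathIn_univ_of_reachable {ω : BondConfig (Fin n)} {x y : Fin n}
    (h : (openGraph ω).Reachable x y) : PathIn (openGraph ω) (Set.univ : Set (Fin n)) x y := by
  rw [SimpleGraph.reachable_iff_reflTransGen] at h
  refine ⟨Set.mem_univ _, ?_⟩
  induction h with
  | refl => exact Relation.ReflTransGen.refl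
  | tail _ hbc ih => exact ih.tail ⟨hbc, Set.mem_univ _⟩

/-- `openConnIn` is symmetric. [folklore] -/
theorem openConnIn_symm' {S : Set (Fin n)} {ω : BondConfig (Fin n)} {x y : Fin n}
    (h : ω ∈ openConnIn S x y) : ω ∈ openConnIn S y x :=
  mem_openConnIn_of_pathIn (pathIn_of_mem_openConnIn h).symm

/-- `openConnIn` is transitive. [folklore] -/
theorem openConnIn_trans' {S : Set (Fin n)} {ω : BondConfig (Fin n)} {x y z : Fin n}
    (h1 : ω ∈ openConnIn S x y) (h2 : ω ∈ openConnIn S y z) : ω ∈ openConnIn S x z :=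
  mem_openConnIn_of_pathIn ((pathIn_of_mem_openConnIn h1).trans (pathIn_of_mem_openConnIn h2))

/-- `openConnIn` is reflexive on its region. [folklore] -/
theorem openConnIn_refl' {S : Set (Fin n)} (ω : BondConfig (Fin n)) {x : Fin n} (hx : x ∈ S) :
    ω ∈ openConnIn S x x :=
  mem_openConnIn_of_pathIn (PathIn.refl hx)

/-! ### Combinatorics on the pocket event -/

section Pocket

variable (A : Finset (Fin n)) (o : Fin n) (W N : Finset (Fin n))

/-- On the pocket event, the pocket is exactly `W`: `o ↔ u` inside `Aᶜ` iff `u ∈ W`. [folklore] -/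
theorem mem_pocket_iff {ω : BondConfig (Fin n)}
    (hP : (Finset.univ.filter fun v => ω ∈ openConnIn ((↑A : Set (Fin n))ᶜ) o v) = W ∧
      (A.filter fun a => ω ∈ openConnIn (insert a ((↑A : Set (Fin n))ᶜ)) o a) = N) (u : Fin n) :
    ω ∈ openConnIn ((↑A : Set (Fin n))ᶜ) o u ↔ u ∈ W := by
  constructor
  · intro h
    rw [← hP.1]
    exact Finset.mem_filter.2 ⟨Finset.mem_univ _, h⟩
  · intro h
    rw [← hP.1] at h
    exact (Finset.mem_filter.1 h).2

/-- On the pocket event, the pocket avoids `A`. [folklore] -/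
theorem notMem_of_mem_pocket {ω : BondConfig (Fin n)}
    (hP : (Finset.univ.filter fun v => ω ∈ openConnIn ((↑A : Set (Fin n))ᶜ) o v) = W ∧
      (A.filter fun a => ω ∈ openConnIn (insert a ((↑A : Set (Fin n))ᶜ)) o a) = N)
    {u : Fin n} (hu : u ∈ W) : u ∉ A := by
  have h := ((mem_pocket_iff A o W N hP u).2 hu)
  have := (pathIn_of_mem_openConnIn h).right_mem
  exact fun huA => this (Finset.mem_coe.2 huA)

/-- On the pocket event, an open pair from `W` to a vertex outside `W` ends at a first contact. [folklore] -/
theorem mem_contacts_of_adj {ω : BondConfig (Fin n)}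
    (hP : (Finset.univ.filter fun v => ω ∈ openConnIn ((↑A : Set (Fin n))ᶜ) o v) = W ∧
      (A.filter fun a => ω ∈ openConnIn (insert a ((↑A : Set (Fin n))ᶜ)) o a) = N)
    {x b : Fin n} (hx : x ∈ W) (hb : b ∉ W) (hadj : (openGraph ω).Adj x b) : b ∈ N := by
  have hox : ω ∈ openConnIn ((↑A : Set (Fin n))ᶜ) o x := (mem_pocket_iff A o W N hP x).2 hx
  -- `b` is a relay: otherwise it would lie in the pocket
  have hbA : b ∈ A := by
    by_contra hbA
    have hbAc : b ∈ ((↑A : Set (Fin n))ᶜ) := fun h => hbA (Finset.mem_coe.1 h)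
    have hob : ω ∈ openConnIn ((↑A : Set (Fin n))ᶜ) o b :=
      mem_openConnIn_of_pathIn ((pathIn_of_mem_openConnIn hox).tail hadj hbAc)
    exact hb ((mem_pocket_iff A o W N hP b).1 hob)
  rw [← hP.2]
  refine Finset.mem_filter.2 ⟨hbA, ?_⟩
  exact mem_openConnIn_of_pathIn
    (((pathIn_of_mem_openConnIn hox).mono (Set.subset_insert _ _)).tail hadj (Set.mem_insert _ _))

/-- First contacts are joined to `o`. [folklore] -/
theorem reachable_of_mem_contacts {ω : BondConfig (Fin n)}
    (hP : (Finset.univ.filter fun v => ω ∈ openConnIn ((↑A : Set (Fin n))ᶜ) o v) = W ∧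
      (A.filter fun a => ω ∈ openConnIn (insert a ((↑A : Set (Fin n))ᶜ)) o a) = N)
    {a : Fin n} (ha : a ∈ N) : (openGraph ω).Reachable o a := by
  rw [← hP.2] at ha
  exact reachable_of_pathIn (pathIn_of_mem_openConnIn (Finset.mem_filter.1 ha).2)

/-- First contacts are relays outside the pocket. [folklore] -/
theorem contacts_subset {ω : BondConfig (Fin n)}
    (hP : (Finset.univ.filter fun v => ω ∈ openConnIn ((↑A : Set (Fin n))ᶜ) o v) = W ∧
      (A.filter fun a => ω ∈ openConnIn (insert a ((↑A : Set (Fin n))ᶜ)) o a) = N)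
    {a : Fin n} (ha : a ∈ N) : a ∈ A ∧ a ∉ W := by
  have haN := ha
  rw [← hP.2] at haN
  have haA : a ∈ A := (Finset.mem_filter.1 haN).1
  exact ⟨haA, fun haW => notMem_of_mem_pocket A o W N hP haW haA⟩

/-- **The cluster of the observer on the pocket event**: for `y ∉ W`, `o ↔ y` iff some first contact is joined to
`y` inside `Wᶜ` (last exit from `W` of an open walk). [folklore] -/
theorem openConn_observer_iff (hoA : o ∉ A) {ω : BondConfig (Fin n)}
    (hP : (Finset.univ.filter fun v => ω ∈ openConnIn ((↑A : Set (Fin n))ᶜ) o v) = W ∧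
      (A.filter fun a => ω ∈ openConnIn (insert a ((↑A : Set (Fin n))ᶜ)) o a) = N)
    {y : Fin n} (hy : y ∉ W) :
    ω ∈ openConn o y ↔ ∃ a ∈ N, ω ∈ openConnIn ((↑W : Set (Fin n))ᶜ) a y := by
  constructor
  · intro hoy
    have hoAc : o ∈ ((↑A : Set (Fin n))ᶜ) := fun h => hoA (Finset.mem_coe.1 h)
    have hoW : o ∈ (↑W : Set (Fin n)) :=
      Finset.mem_coe.2 ((mem_pocket_iff A o W N hP o).1 (openConnIn_refl' ω hoAc))
    rcases (pathIn_univ_of_reachable hoy).last_exit_or hoW with hyW | ⟨a, b, haW, -, hbW, hadj, hpath⟩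
    · exact absurd (Finset.mem_coe.1 hyW) hy
    · have hbN : b ∈ N :=
        mem_contacts_of_adj A o W N hP (Finset.mem_coe.1 haW) (fun h => hbW (Finset.mem_coe.2 h)) hadj
      exact ⟨b, hbN, mem_openConnIn_of_pathIn (hpath.mono fun z hz => hz.2)⟩
  · rintro ⟨a, haN, hay⟩
    exact (reachable_of_mem_contacts A o W N hP haN).trans (reachable_of_pathIn (pathIn_of_mem_openConnIn hay))

/-- **The cluster of a relay on the pocket event**: for a vertex `c ∉ W` and `y ∉ W`, `c ↔ y` iff either `c ↔ y`
inside `Wᶜ`, or `c` is joined inside `Wᶜ` to a first contact and `y` lies in the cluster of the observer (first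
entry into `W` of an open walk). [folklore] -/
theorem openConn_relay_iff (hoA : o ∉ A) {ω : BondConfig (Fin n)}
    (hP : (Finset.univ.filter fun v => ω ∈ openConnIn ((↑A : Set (Fin n))ᶜ) o v) = W ∧
      (A.filter fun a => ω ∈ openConnIn (insert a ((↑A : Set (Fin n))ᶜ)) o a) = N)
    {c y : Fin n} (hc : c ∉ W) (hy : y ∉ W) :
    ω ∈ openConn c y ↔
      ω ∈ openConnIn ((↑W : Set (Fin n))ᶜ) c y ∨
        ((∃ a ∈ N, ω ∈ openConnIn ((↑W : Set (Fin n))ᶜ) c a) ∧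
          ∃ a ∈ N, ω ∈ openConnIn ((↑W : Set (Fin n))ᶜ) a y) := by
  constructor
  · intro hcy
    have hcWc : c ∈ ((↑W : Set (Fin n))ᶜ) := fun h => hc (Finset.mem_coe.1 h)
    rcases (pathIn_univ_of_reachable hcy).exit_or hcWc with hin | ⟨a, b, haWc, hbW, -, hadj, hpath⟩
    · exact Or.inl (mem_openConnIn_of_pathIn (hin.mono fun z hz => hz.1))
    · -- first entry into `W` through the open pair `a–b`, `a ∉ W`, `b ∈ W`
      right
      have hbW' : b ∈ W := by
        by_contra h
        exact hbW (fun hb => h (Finset.mem_coe.1 hb))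
      have haN : a ∈ N :=
        mem_contacts_of_adj A o W N hP hbW' (fun h => haWc (Finset.mem_coe.2 h)) hadj.symm
      have hca : ω ∈ openConnIn ((↑W : Set (Fin n))ᶜ) c a :=
        mem_openConnIn_of_pathIn (hpath.mono fun z hz => hz.1)
      refine ⟨⟨a, haN, hca⟩, ?_⟩
      -- `o ↔ a ↔ c ↔ y`, then last exit from `W`
      have hoy : ω ∈ openConn o y :=
        ((reachable_of_mem_contacts A o W N hP haN).trans
          (reachable_of_pathIn (pathIn_of_mem_openConnIn hca)).symm).trans hcy
      exact (openConn_observer_iff A o W N hoA hP hy).1 hoy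
  · rintro (h | ⟨⟨a, haN, hca⟩, ⟨a', ha'N, ha'y⟩⟩)
    · exact reachable_of_pathIn (pathIn_of_mem_openConnIn h)
    · have h1 : (openGraph ω).Reachable c a := reachable_of_pathIn (pathIn_of_mem_openConnIn hca)
      have h2 : (openGraph ω).Reachable o a := reachable_of_mem_contacts A o W N hP haN
      have h3 : (openGraph ω).Reachable o a' := reachable_of_mem_contacts A o W N hP ha'N
      have h4 : (openGraph ω).Reachable a' y := reachable_of_pathIn (pathIn_of_mem_openConnIn ha'y)
      exact ((h1.trans h2.symm).trans h3).trans h4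

/-- Relays lie outside the pocket. [folklore] -/
theorem notMem_pocket_of_mem_relays {ω : BondConfig (Fin n)}
    (hP : (Finset.univ.filter fun v => ω ∈ openConnIn ((↑A : Set (Fin n))ᶜ) o v) = W ∧
      (A.filter fun a => ω ∈ openConnIn (insert a ((↑A : Set (Fin n))ᶜ)) o a) = N)
    {x : Fin n} (hx : x ∈ A) : x ∉ W :=
  fun hxW => notMem_of_mem_pocket A o W N hP hxW hx

/-- **The lower-tail event on the pocket event** (`N ≠ ∅`): `{1 ≤ N ≤ j} ∩ P = P ∩ {the port block is j-small
inside Wᶜ}`. [folklore] -/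
theorem lowerTail_inter_pocket (hoA : o ∉ A) (hN : N.Nonempty) (j : ℕ) :
    {ω : BondConfig (Fin n) |
        (Finset.univ.filter fun v => ω ∈ openConnIn ((↑A : Set (Fin n))ᶜ) o v) = W ∧
        (A.filter fun a => ω ∈ openConnIn (insert a ((↑A : Set (Fin n))ᶜ)) o a) = N} ∩
      {ω : BondConfig (Fin n) | 1 ≤ (A.filter fun x => ω ∈ openConn o x).card ∧
        (A.filter fun x => ω ∈ openConn o x).card ≤ j} =
    {ω : BondConfig (Fin n) |
        (Finset.univ.filter fun v => ω ∈ openConnIn ((↑A : Set (Fin n))ᶜ) o v) = W ∧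
        (A.filter fun a => ω ∈ openConnIn (insert a ((↑A : Set (Fin n))ᶜ)) o a) = N} ∩
      {ω : BondConfig (Fin n) |
        (A.filter fun y => ∃ a ∈ N, ω ∈ openConnIn ((↑W : Set (Fin n))ᶜ) a y).card ≤ j} := by
  ext ω
  simp only [mem_inter_iff, mem_setOf_eq]
  constructor
  · rintro ⟨hP, -, h2⟩
    refine ⟨hP, ?_⟩
    have hfil : (A.filter fun x => ω ∈ openConn o x) =
        (A.filter fun y => ∃ a ∈ N, ω ∈ openConnIn ((↑W : Set (Fin n))ᶜ) a y) :=
      Finset.filter_congr fun x hx =>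
        openConn_observer_iff A o W N hoA hP (notMem_pocket_of_mem_relays A o W N hP hx)
    rw [← hfil]
    exact h2
  · rintro ⟨hP, h⟩
    have hfil : (A.filter fun x => ω ∈ openConn o x) =
        (A.filter fun y => ∃ a ∈ N, ω ∈ openConnIn ((↑W : Set (Fin n))ᶜ) a y) :=
      Finset.filter_congr fun x hx =>
        openConn_observer_iff A o W N hoA hP (notMem_pocket_of_mem_relays A o W N hP hx)
    refine ⟨hP, ?_, ?_⟩
    · obtain ⟨a, ha⟩ := hN
      obtain ⟨haA, haW⟩ := contacts_subset A o W N hP ha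
      refine Nat.succ_le_of_lt (Finset.card_pos.2 ⟨a, Finset.mem_filter.2 ⟨haA, ?_⟩⟩)
      exact reachable_of_mem_contacts A o W N hP ha
    · rw [hfil]
      exact h

/-- **The detachment of a relay on the pocket event**: for `c ∈ A`, `{|π(c)| ≤ j} ∩ P = P ∩ {c is j-small in
G[Wᶜ] + K_N}`, the latter read inside `Wᶜ`: if `c ↔ N` inside `Wᶜ` the port block is small, otherwise `c` is small
inside `Wᶜ`. [folklore] -/
theorem relaySmall_inter_pocket (hoA : o ∉ A) {c : Fin n} (hc : c ∈ A) (j : ℕ) :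
    {ω : BondConfig (Fin n) |
        (Finset.univ.filter fun v => ω ∈ openConnIn ((↑A : Set (Fin n))ᶜ) o v) = W ∧
        (A.filter fun a => ω ∈ openConnIn (insert a ((↑A : Set (Fin n))ᶜ)) o a) = N} ∩
      {ω : BondConfig (Fin n) | (A.filter fun x => ω ∈ openConn c x).card ≤ j} =
    {ω : BondConfig (Fin n) |
        (Finset.univ.filter fun v => ω ∈ openConnIn ((↑A : Set (Fin n))ᶜ) o v) = W ∧
        (A.filter fun a => ω ∈ openConnIn (insert a ((↑A : Set (Fin n))ᶜ)) o a) = N} ∩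
      {ω : BondConfig (Fin n) |
        ((∃ a ∈ N, ω ∈ openConnIn ((↑W : Set (Fin n))ᶜ) c a) ∧
            (A.filter fun y => ∃ a ∈ N, ω ∈ openConnIn ((↑W : Set (Fin n))ᶜ) a y).card ≤ j) ∨
          ((¬ ∃ a ∈ N, ω ∈ openConnIn ((↑W : Set (Fin n))ᶜ) c a) ∧
            (A.filter fun y => ω ∈ openConnIn ((↑W : Set (Fin n))ᶜ) c y).card ≤ j)} := by
  ext ω
  simp only [mem_inter_iff, mem_setOf_eq]
  refine and_congr_right fun hP => ?_
  have hcW : c ∉ W := notMem_pocket_of_mem_relays A o W N hP hc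
  by_cases hcN : ∃ a ∈ N, ω ∈ openConnIn ((↑W : Set (Fin n))ᶜ) c a
  · -- `c` rides on the port block
    obtain ⟨a₀, ha₀, hca₀⟩ := hcN
    have hfil : (A.filter fun x => ω ∈ openConn c x) =
        (A.filter fun y => ∃ a ∈ N, ω ∈ openConnIn ((↑W : Set (Fin n))ᶜ) a y) := by
      refine Finset.filter_congr fun x hx => ?_
      rw [openConn_relay_iff A o W N hoA hP hcW (notMem_pocket_of_mem_relays A o W N hP hx)]
      constructor
      · rintro (h | ⟨-, h⟩)
        · exact ⟨a₀, ha₀, openConnIn_trans' (openConnIn_symm' hca₀) h⟩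
        · exact h
      · intro h
        exact Or.inr ⟨⟨a₀, ha₀, hca₀⟩, h⟩
    rw [hfil]
    constructor
    · intro h; exact Or.inl ⟨⟨a₀, ha₀, hca₀⟩, h⟩
    · rintro (⟨-, h⟩ | ⟨h, -⟩)
      · exact h
      · exact absurd ⟨a₀, ha₀, hca₀⟩ h
  · -- `c` does not meet the port block inside `Wᶜ`: its cluster is its cluster inside `Wᶜ`
    have hfil : (A.filter fun x => ω ∈ openConn c x) =
        (A.filter fun y => ω ∈ openConnIn ((↑W : Set (Fin n))ᶜ) c y) := by
      refine Finset.filter_congr fun x hx => ?_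
      rw [openConn_relay_iff A o W N hoA hP hcW (notMem_pocket_of_mem_relays A o W N hP hx)]
      constructor
      · rintro (h | ⟨h, -⟩)
        · exact h
        · exact absurd h hcN
      · intro h; exact Or.inl h
    rw [hfil]
    constructor
    · intro h; exact Or.inr ⟨hcN, h⟩
    · rintro (⟨h, -⟩ | ⟨-, h⟩)
      · exact absurd h hcN
      · exact h

/-- On the pocket event with `c ∈ N`, the lower-tail event forces `c` to be `j`-small and `o ↔ A`. [folklore] -/
theorem lowerTail_inter_pocket_subset_of_mem {c : Fin n} (hcN : c ∈ N) (j : ℕ) :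
    {ω : BondConfig (Fin n) |
        (Finset.univ.filter fun v => ω ∈ openConnIn ((↑A : Set (Fin n))ᶜ) o v) = W ∧
        (A.filter fun a => ω ∈ openConnIn (insert a ((↑A : Set (Fin n))ᶜ)) o a) = N} ∩
      {ω : BondConfig (Fin n) | 1 ≤ (A.filter fun x => ω ∈ openConn o x).card ∧
        (A.filter fun x => ω ∈ openConn o x).card ≤ j} ⊆
    {ω : BondConfig (Fin n) |
        (Finset.univ.filter fun v => ω ∈ openConnIn ((↑A : Set (Fin n))ᶜ) o v) = W ∧
        (A.filter fun a => ω ∈ openConnIn (insert a ((↑A : Set (Fin n))ᶜ)) o a) = N} ∩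
      ((⋃ a' ∈ A, (openConn o a' : Set (BondConfig (Fin n)))) ∩
        {ω : BondConfig (Fin n) | (A.filter fun x => ω ∈ openConn c x).card ≤ j}) := by
  rintro ω ⟨hP, -, h2⟩
  have hoc : (openGraph ω).Reachable o c := reachable_of_mem_contacts A o W N hP hcN
  have hcA : c ∈ A := (contacts_subset A o W N hP hcN).1
  refine ⟨hP, mem_iUnion₂.2 ⟨c, hcA, hoc⟩, ?_⟩
  have hfil : (A.filter fun x => ω ∈ openConn c x) = (A.filter fun x => ω ∈ openConn o x) :=
    Finset.filter_congr fun x _ =>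
      ⟨fun h => hoc.trans h, fun h => hoc.symm.trans h⟩
  simp only [mem_setOf_eq, hfil]
  exact h2

/-- On the pocket event with `N = ∅`, the observer meets no relay. [folklore] -/
theorem lowerTail_inter_pocket_empty (hoA : o ∉ A) (hN : N = ∅) (j : ℕ) :
    {ω : BondConfig (Fin n) |
        (Finset.univ.filter fun v => ω ∈ openConnIn ((↑A : Set (Fin n))ᶜ) o v) = W ∧
        (A.filter fun a => ω ∈ openConnIn (insert a ((↑A : Set (Fin n))ᶜ)) o a) = N} ∩
      {ω : BondConfig (Fin n) | 1 ≤ (A.filter fun x => ω ∈ openConn o x).card ∧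
        (A.filter fun x => ω ∈ openConn o x).card ≤ j} = ∅ := by
  ext ω
  simp only [mem_inter_iff, mem_setOf_eq, mem_empty_iff_false, iff_false, not_and]
  intro hP h1 _
  obtain ⟨x, hx⟩ := Finset.card_pos.1 (Nat.lt_of_succ_le h1)
  obtain ⟨hxA, hox⟩ := Finset.mem_filter.1 hx
  obtain ⟨a, haN, -⟩ :=
    (openConn_observer_iff A o W N hoA hP (notMem_pocket_of_mem_relays A o W N hP hxA)).1 hox
  rw [hN] at haN
  exact absurd haN (Finset.notMem_empty a)


end Pocket


end LossyPocket

end Summit.CriticalPhenomena.PercolationContinuityZ3.Theorems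

end
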